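import Summits.QuantumFields.BalabanUV.T4Continuum.Support.RegionSliceCoerciveBox
import Summits.QuantumFields.BalabanUV.T4Continuum.Support.DirichletInjectedDefect

/-!
# T⁴ programme, spine node NE2 (U1a), sub-row Δ1 «NE2⁰-Dirichlet» — THE INJECTED LAW W3̃ OF THE BOX STAR TOWER REDUCED TO A TWO-LEVEL
# COMMUTATOR PAIRING with budgets (skeleton of owner item O14-b «W3̃-BOX at rate (√L)⁻¹»)

Row NE2 OWNER (unit `b2b-balaban-t4-ne2-p1`, gen 14; R32 (d), journal 2026-08-20 l.20841), file 1 of O14-b: BOOKKEEPING ONLY.  After O14-a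
(`Support/RegionSliceCoerciveBox`, p235372: W1 on every coordinate box is a theorem; the box star tower of the faithful `Δ_a(Ω₀)` converges at
rate `(√L)⁻¹` MODULO the injected law `hinj : ‖G_{k+1}J̃_k − J̃_kG_k‖ ≤ C₁(√L)^{−k}` ONLY — `towerLimitRate_star_renorm_box_sqrt`; the rate `L⁻¹`
is REFUTED on slabs by leaf-02-g7's `DirichletStarRenormSlabNoGo.not_renorm_injected_torus_rate`), the LAST displayed binder on boxes is W3̃.
This file types its reduction (gan24-p2-g22's `injected_le_box` pattern for the scalar box tower, now for the VECTOR star tower), so that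
the analytic content is TWO displayed leaves with budgets left as parameters:

 * §1 GENERIC (any Hermitian invertible `X`, invertible `Y`, any `J`, any budgets `E`, `E′`):
   **`opNorm_injected_le_of_pairing`** — from the sandwich `X⁻¹J − JY⁻¹ = X⁻¹(JY − XJ)Y⁻¹` (gen 11 `DirichletInjectedDefect.inv_mul_sub_mul_inv`),
   a COMMUTATOR PAIRING `‖⟨v, (JY − XJ)u⟩‖ ≤ ε·√E(u)·√E′(v)` and BUDGET BOUNDS `√E(Y⁻¹f) ≤ Λ·√nsq f`, `√E′(X⁻¹g) ≤ Λ′·√nsq g` give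
   `‖X⁻¹J − JY⁻¹‖ ≤ ε·Λ·Λ′` (gan24's `DirichletBoxCompression.opNorm_le_of_pairing`).
 * §2 THE STAR TOWER ON A BOX: **`hinj_of_pairing`** (`∀ k`, pairing at `ε_k` and budgets `Λ_k`, `Λ′_k` with `ε_k·Λ_k·Λ′_k ≤ C₁·θ^k` ⟹ W3̃ at
   rate `θ`) and the END **`towerLimitRate_star_renorm_box_of_pairing`** = O14-a's `towerLimitRate_star_renorm_box_sqrt` with `hinj`
   DISCHARGED from the two displayed leaves at `θ = (√L)⁻¹`:
   (P) `∀ k u v, ‖star v ⬝ᵥ ((J̃_k·Δ_a^{(k)}(Ω₀) − Δ_a^{(k+1)}(Ω₀)·J̃_k) *ᵥ u)‖ ≤ ε k·√(E k u)·√(E′ k v)` — the two-level COMMUTATOR of the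
       renormalised planting with the faithful region operators (curl part: King's planted consistency inside the blocks + the star boundary;
       gauge part: the region projections `R(Ω₀)` at two spacings — itself a two-level law of the SCALAR box problem, cf. gan24 `injected_le_box`;
       mass part: the averaging/planting intertwining `sqrt_smul_AnR_mul_JnR`);
   (R) `∀ k f, √(E k (G_k f)) ≤ Λ k·√nsq f`, `∀ k g, √(E′ k (G_{k+1} g)) ≤ Λ′ k·√nsq g` — budget regularity of the region propagators (energy:
       `Re⟨Gf, f⟩ ≤ γ⋆⁻¹‖f‖²` is in the tree; Hessian-type budgets need the corner-free `H²` of the vector problem — OPEN).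
   The budgets `E`, `E′` are PARAMETERS here: their design (which makes (P) hold with `ε_k ≍ n_k^{−1/2}`, the rate located by leaf-02-g7's
   boundary-layer lower bound) is the analytic item O14-b proper.

HONEST FRAMING (T4-DAG p. 1).  Model level (`U = 1`, ONE region = a coordinate box, ONE averaging scale, finite torus, operator norm);
[folklore] bookkeeping; (P) and (R) are DISPLAYED, not proved; W3̃ on boxes OPEN; NOT [B9] (3.16)/(3.23)–(3.27)/(3.42) as printed ([B9] prints only
η-uniform bounds for these propagators; the two-spacing law is «not in print; our proof attempt»); NE2 (U1a) NOT proved; spine PROVED 0/9 unchanged;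
NOT infinite volume / mass gap / Clay.  HONEST DEPENDENCY: continuum YM on T⁴ ⇐ BetaPertH ∧ nine spine estimates (0/9 proved); BetaPertH ⇐ (D1) ∧
(D4) ∧ CAP+tail; G-an2-4 gates asym, D1 and NE2/3/4.  No `sorry`.
-/

noncomputable section

open scoped BigOperators ComplexConjugate Matrix Matrix.Norms.L2Operator
open Finset

namespace Summit.QuantumFields.BalabanUV.T4Continuum.RegionStarInjectedPairing

open Literature.MathematicalPhysics.QuantumFieldTheory.Balaban1983to89.B5Prop11Plancherel (Tor fine)
open Literature.MathematicalPhysics.QuantumFieldTheory.Balaban1983to89.B5Prop11Lower (nsq nsq_nonneg)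
open Literature.MathematicalPhysics.QuantumFieldTheory.Balaban1983to89.B5Action121 (star_mulVec_dotProduct)
open Literature.MathematicalPhysics.QuantumFieldTheory.Balaban1983to89.B5G183RateUnitTower (lev)
open Summit.QuantumFields.BalabanUV.T4Continuum
open Summit.QuantumFields.BalabanUV.T4Continuum.BackgroundResolventTower (Cpert)
open Summit.QuantumFields.BalabanUV.T4Continuum.CovariantAveragingTower (TowerLimitRate)
open Summit.QuantumFields.BalabanUV.T4Continuum.RegionGaugeFixedVector (starReg regionDeltaA)
open Summit.QuantumFields.BalabanUV.T4Continuum.RegionGaugeFixedVectorFlat (isUnit_det_regionDeltaA)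
open Summit.QuantumFields.BalabanUV.T4Continuum.DirichletSubregionTowerOf (pidx)
open Summit.QuantumFields.BalabanUV.T4Continuum.DirichletSubregionRenormTower (JnR AnR)
open Summit.QuantumFields.BalabanUV.T4Continuum.DirichletStarVectorTower (starP gamStar regionDeltaA_isHermitian)
open Summit.QuantumFields.BalabanUV.T4Continuum.DirichletInjectedDefect (inv_mul_sub_mul_inv)
open Summit.QuantumFields.BalabanUV.T4Continuum.RegionInteriorW2 (CgIbox)
open Summit.QuantumFields.BalabanUV.T4Continuum.RegionSliceCoerciveBoxTower (cW1box)
open Summit.QuantumFields.BalabanUV.T4Continuum.RegionSliceCoerciveBox (towerLimitRate_star_renorm_box_sqrt)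
open Summit.QuantumFields.BalabanUV.Beta.GAN24.DirichletBoxCompression (opNorm_le_of_pairing)
open Summit.QuantumFields.BalabanUV.Beta.GAN24.DirichletBoxTwoLevel (IsCoordBox)

variable {d : ℕ}

/-! ## §1 Generic: the injected defect from a commutator pairing with budgets -/

section Generic

variable {m m' : Type*} [Fintype m] [DecidableEq m] [Fintype m'] [DecidableEq m']

/-- the sandwich, read in a pairing: `⟨w, (X⁻¹J − JY⁻¹)f⟩ = ⟨X⁻¹w, (JY − XJ)(Y⁻¹f)⟩` for Hermitian invertible `X`, invertible `Y`. [folklore] -/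
theorem pairing_sandwich {X : Matrix m' m' ℂ} {Y : Matrix m m ℂ} (hXh : X.IsHermitian) (hX : IsUnit X.det) (hY : IsUnit Y.det)
    (J : Matrix m' m ℂ) (w : m' → ℂ) (f : m → ℂ) :
    star w ⬝ᵥ ((X⁻¹ * J - J * Y⁻¹) *ᵥ f) = star (X⁻¹ *ᵥ w) ⬝ᵥ ((J * Y - X * J) *ᵥ (Y⁻¹ *ᵥ f)) := by
  have hXih : (X⁻¹).IsHermitian := hXh.inv
  rw [inv_mul_sub_mul_inv hX hY J, Matrix.mul_assoc, ← Matrix.mulVec_mulVec, ← Matrix.mulVec_mulVec, star_mulVec_dotProduct, hXih.eq]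

/-- **THE INJECTED DEFECT FROM A COMMUTATOR PAIRING WITH BUDGETS**: if `‖⟨v, (JY − XJ)u⟩‖ ≤ ε·√E(u)·√E′(v)` for all `u`, `v` and the
propagators map into the budgets (`√E(Y⁻¹f) ≤ Λ·√nsq f`, `√E′(X⁻¹g) ≤ Λ′·√nsq g`), then `‖X⁻¹J − JY⁻¹‖ ≤ ε·Λ·Λ′`. [folklore] -/
theorem opNorm_injected_le_of_pairing {X : Matrix m' m' ℂ} {Y : Matrix m m ℂ} (hXh : X.IsHermitian) (hX : IsUnit X.det) (hY : IsUnit Y.det)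
    (J : Matrix m' m ℂ) {E : (m → ℂ) → ℝ} {E' : (m' → ℂ) → ℝ} {ε Λ Λ' : ℝ} (hε : 0 ≤ ε) (hΛ : 0 ≤ Λ) (hΛ' : 0 ≤ Λ')
    (hP : ∀ (u : m → ℂ) (v : m' → ℂ), ‖star v ⬝ᵥ ((J * Y - X * J) *ᵥ u)‖ ≤ ε * Real.sqrt (E u) * Real.sqrt (E' v))
    (hR : ∀ f : m → ℂ, Real.sqrt (E (Y⁻¹ *ᵥ f)) ≤ Λ * Real.sqrt (nsq f))
    (hR' : ∀ g : m' → ℂ, Real.sqrt (E' (X⁻¹ *ᵥ g)) ≤ Λ' * Real.sqrt (nsq g)) :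
    ‖X⁻¹ * J - J * Y⁻¹‖ ≤ ε * Λ * Λ' := by
  refine opNorm_le_of_pairing _ (by positivity) fun w f => ?_
  rw [pairing_sandwich hXh hX hY J w f]
  have h1 := hP (Y⁻¹ *ᵥ f) (X⁻¹ *ᵥ w)
  have h2 := hR f
  have h3 := hR' w
  have hs0 : 0 ≤ Real.sqrt (E (Y⁻¹ *ᵥ f)) := Real.sqrt_nonneg _
  have hs1 : 0 ≤ Real.sqrt (E' (X⁻¹ *ᵥ w)) := Real.sqrt_nonneg _
  calc ‖star (X⁻¹ *ᵥ w) ⬝ᵥ ((J * Y - X * J) *ᵥ (Y⁻¹ *ᵥ f))‖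
      ≤ ε * Real.sqrt (E (Y⁻¹ *ᵥ f)) * Real.sqrt (E' (X⁻¹ *ᵥ w)) := h1
    _ ≤ ε * (Λ * Real.sqrt (nsq f)) * (Λ' * Real.sqrt (nsq w)) := by gcongr
    _ = ε * Λ * Λ' * Real.sqrt (nsq w) * Real.sqrt (nsq f) := by ring

end Generic

/-! ## §2 The star tower on a box: W3̃ from the two displayed leaves -/

section Tower

variable (L : ℕ) [NeZero L] (M : Fin d → ℕ) [hM : ∀ μ, NeZero (M μ)] (a a' : ℝ) (S : Tor M → Prop) [DecidablePred S]

/-- **W3̃ FROM (P) + (R)** along the star tower of `Δ_a(Ω₀)` (any region, `0 < a`, `0 < a′`): with per-level pairing constants `ε_k` and budget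
bounds `Λ_k`, `Λ′_k` such that `ε_k·Λ_k·Λ′_k ≤ C₁·θ^k`, the injected law holds at rate `θ`. [folklore] -/
theorem hinj_of_pairing (ha : 0 < a) (ha' : 0 < a')
    {E : (k : ℕ) → (pidx L M (starP L M S) k → ℂ) → ℝ} {E' : (k : ℕ) → (pidx L M (starP L M S) (k + 1) → ℂ) → ℝ}
    {ε Λ Λ' : ℕ → ℝ} (hε : ∀ k, 0 ≤ ε k) (hΛ : ∀ k, 0 ≤ Λ k) (hΛ' : ∀ k, 0 ≤ Λ' k)
    (hP : ∀ (k : ℕ) (u : pidx L M (starP L M S) k → ℂ) (v : pidx L M (starP L M S) (k + 1) → ℂ),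
      ‖star v ⬝ᵥ ((JnR L M (starP L M S) k * regionDeltaA (lev L k) M a a' S
          - regionDeltaA (lev L (k + 1)) M a a' S * JnR L M (starP L M S) k) *ᵥ u)‖
        ≤ ε k * Real.sqrt (E k u) * Real.sqrt (E' k v))
    (hR : ∀ (k : ℕ) (f : pidx L M (starP L M S) k → ℂ),
      Real.sqrt (E k ((regionDeltaA (lev L k) M a a' S)⁻¹ *ᵥ f)) ≤ Λ k * Real.sqrt (nsq f))
    (hR' : ∀ (k : ℕ) (g : pidx L M (starP L M S) (k + 1) → ℂ),
      Real.sqrt (E' k ((regionDeltaA (lev L (k + 1)) M a a' S)⁻¹ *ᵥ g)) ≤ Λ' k * Real.sqrt (nsq g))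
    {C₁ θ : ℝ} (hrate : ∀ k, ε k * Λ k * Λ' k ≤ C₁ * θ ^ k) (k : ℕ) :
    ‖(regionDeltaA (lev L (k + 1)) M a a' S)⁻¹ * JnR L M (starP L M S) k
        - JnR L M (starP L M S) k * (regionDeltaA (lev L k) M a a' S)⁻¹‖ ≤ C₁ * θ ^ k :=
  (opNorm_injected_le_of_pairing (regionDeltaA_isHermitian (lev L (k + 1)) M a a' S)
    (isUnit_det_regionDeltaA (lev L (k + 1)) M a a' S ha ha') (isUnit_det_regionDeltaA (lev L k) M a a' S ha ha')
    (JnR L M (starP L M S) k) (hε k) (hΛ k) (hΛ' k) (hP k) (hR k) (hR' k)).trans (hrate k)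

/-- **THE BOX STAR TOWER AT RATE `(√L)⁻¹` MODULO THE TWO DISPLAYED LEAVES (P) + (R)** = O14-a's `towerLimitRate_star_renorm_box_sqrt` with
`hinj` DISCHARGED by `hinj_of_pairing` at `θ = (√L)⁻¹`. [folklore] -/
theorem towerLimitRate_star_renorm_box_of_pairing (hL : 2 ≤ L) (hbox : IsCoordBox M S) (ha : 0 < a) (ha' : 0 < a')
    {E : (k : ℕ) → (pidx L M (starP L M S) k → ℂ) → ℝ} {E' : (k : ℕ) → (pidx L M (starP L M S) (k + 1) → ℂ) → ℝ}
    {ε Λ Λ' : ℕ → ℝ} (hε : ∀ k, 0 ≤ ε k) (hΛ : ∀ k, 0 ≤ Λ k) (hΛ' : ∀ k, 0 ≤ Λ' k)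
    (hP : ∀ (k : ℕ) (u : pidx L M (starP L M S) k → ℂ) (v : pidx L M (starP L M S) (k + 1) → ℂ),
      ‖star v ⬝ᵥ ((JnR L M (starP L M S) k * regionDeltaA (lev L k) M a a' S
          - regionDeltaA (lev L (k + 1)) M a a' S * JnR L M (starP L M S) k) *ᵥ u)‖
        ≤ ε k * Real.sqrt (E k u) * Real.sqrt (E' k v))
    (hR : ∀ (k : ℕ) (f : pidx L M (starP L M S) k → ℂ),
      Real.sqrt (E k ((regionDeltaA (lev L k) M a a' S)⁻¹ *ᵥ f)) ≤ Λ k * Real.sqrt (nsq f))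
    (hR' : ∀ (k : ℕ) (g : pidx L M (starP L M S) (k + 1) → ℂ),
      Real.sqrt (E' k ((regionDeltaA (lev L (k + 1)) M a a' S)⁻¹ *ᵥ g)) ≤ Λ' k * Real.sqrt (nsq g))
    {C₁ : ℝ} (hrate : ∀ k, ε k * Λ k * Λ' k ≤ C₁ * ((Real.sqrt L)⁻¹) ^ k) :
    TowerLimitRate (AnR L M (starP L M S)) ((L : ℝ) ^ d) (fun k => (regionDeltaA (lev L k) M a a' S)⁻¹)
      (Cpert 0 (Real.sqrt (CgIbox d a' (cW1box d a a' 4) / 2 * (gamStar d a' (cW1box d a a' 4))⁻¹)) C₁ 0 0 0) ((Real.sqrt L)⁻¹) :=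
  towerLimitRate_star_renorm_box_sqrt M a a' S L hL hbox ha ha'
    (hinj_of_pairing L M a a' S ha ha' hε hΛ hΛ' hP hR hR' hrate)

end Tower

end Summit.QuantumFields.BalabanUV.T4Continuum.RegionStarInjectedPairing

end
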